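import Summits.BirchSwinnertonDyer.BirchSwinnertonDyer.Theorems.PrintX8SharpFlatMuTransfer
import Summits.BirchSwinnertonDyer.BirchSwinnertonDyer.Theorems.PrintX8SharpFlatRankZeroRoad
import Summits.BirchSwinnertonDyer.Rank1Residual.Additive.TameBranchBudgetSqueeze
import HarnessLib

/-!
# Route `PrintX8`, crux `SharpFlatMainConjectureSmallImageX8` (stmt-BirchSwinnertonDyer-20402): the UNIT
# CASE at small image — `ord₃(L(E,1)/Ω_E) = 0` at an X8 pair with `ρ̄_{E,3}` NOT onto ⟹ Sprung's Main
# [C] 7.21 for BOTH colours and `BSD(E,3)` in analytic rank `0`, PARTNER-FREE, with NO Eisenstein input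
# (cell `bsd-print-x8`, seat p1 gen 2; `--supports` 20402; theorems only)

PARTITION (cell bsd-print-x8, leaf `ClassX8`; census: the 61 small-image X8 cells contain exactly the
population's 2 UNIT cells, 135200bx1 and 442225bz1 — ref U1 / ty3): types-the-object-of; closes NONE
class-wide; gives a by-name road for the 2 unit cells (per-pair records are a separate file). beyond-print
theorem: no. BSD is not proved by any of this.

HONEST FRAMING. Ref U1 (REF-AUDIT, 2026-08-27T13:31Z): «the 2 unit cells are BOTH N_ns(3) cells — no
printed upper half applies (Kato needs big image; Wuthrich Prop 21 excludes «neither surjective nor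
reducible»; Kolyvagin needs ρ̄ onto) ⇒ 0 unit cells closable from print»; the Heegner-index road (GEN-22)
also failed on both (R-31). THIS file gives a third road, the ♯/♭ twin of bsd-ssimc's
`SmallImageSignedMuTransfer.kobayashiMainConjecture_of_lvalue_unit` (`a_p = 0`): at a unit pair
`L^•(0) = c_• · L(E,1)/Ω⁺_f` is a `3`-adic unit (Sprung 2017 Cor. 4.11 + `3 ∤ c_•` on X8 + the period
unit at `3`), so `L^• ∈ Λˣ` and `μ(L^•) = 0`; the μ-transfer (`X8.sharpFlatMu_eq_zero`, from the
construction fact `thm714seq_sharpFlatColemanKato_zeta`) gives `μ(X^•) = 0`, i.e. a characteristic power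
series `ξ` of unit content; Sprung 2012 Thm. 7.16 RATIONAL + Gauss' lemma give `ξ ∣ L^•`, so `ξ ∈ Λˣ`
and `char X^• = Λ = (ϖ·L^•)`: BOTH halves of Main [C] 7.21 are trivial — NO K1, NO partner, NO image
hypothesis beyond «not onto». Then p1 g0's image-free rank-zero road
(`X8MainConjectureRoad.X8.bsdp_of_sprungSharpFlatMainConjecture_of_analyticRank_eq_zero`, Sprung 2024
§5.2 all `N`) gives `BSD(E,3)`.

## Contents
* `X8.isUnit_chromaticL_of_lvalue_unit` — on X8 (any image), a newform `f`, period ratio `ϖ`, Sprung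
  pair: `ord₃(L(E,1)/Ω_E) = 0 ⟹ L^• ∈ Λˣ` (both colours), modulo the period fact at `3`.
* `X8.sprungSharpFlatMainConjecture_of_lvalue_unit_of_not_surj` — X8, `¬ Surj W 3`, unit `L`-value ⟹
  `SprungSharpFlatMainConjecture W 3 •` for every colour, modulo `hCK`, Sprung 2012 Thm. 7.14, Thm. 7.16
  (rational clause) and the period fact at `3`.
* `X8.bsdp_of_lvalue_unit_of_not_surj_of_analyticRank_eq_zero` — the same pair with analytic rank `0`
  ⟹ `BSDp W 3`, adding BY NAME modularity (`exists_isNewformOf`, `hasEntireLFunction_rat`), Sprung 2012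
  Thm. 2.2, Sprung 2024 Lemma 5.9 all `N` (flag allN), GZK.

References: [Sprung2012] Thm. 2.2, Def. 6.1, Thm. 7.14, Thm. 7.16, Main [C] 7.21; [Sprung2017] Cor. 4.11;
[Sprung2024] §5.2; [Kato2004Asterisque] Thm. 12.6, §13.8; [GreenbergVatsal2000] §3 Rem. 3.4;
[Washington1997] §7.1, §13.1 (Gauss in `Λ`).
-/

set_option linter.dupNamespace false
set_option autoImplicit false

noncomputable section

open scoped Classical NumberField MatrixGroups ModularForm

open NumberField IsDedekindDomain WeierstrassCurve CongruenceSubgroup Field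
  Literature.NumberTheory.EllipticCurves Literature.NumberTheory.EllipticCurves.ModularForms
  Literature.NumberTheory.EllipticCurves.Rank1Residual
  Literature.NumberTheory.EllipticCurves.Rank1Residual.Typed
  Literature.NumberTheory.EllipticCurves.Sprung2017 Literature.NumberTheory.EllipticCurves.Sprung2012
  Literature.NumberTheory.EllipticCurves.Sprung2024
  Literature.NumberTheory.EllipticCurves.Kato2004 Literature.NumberTheory.EllipticCurves.GreenbergVatsal2000
  Literature.NumberTheory.EllipticCurves.ZpExtension Literature.NumberTheory.EllipticCurves.IwasawaAlgebra
  Summit.BirchSwinnertonDyer.BirchSwinnertonDyer.Rank1Residual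
  Summit.BirchSwinnertonDyer.BirchSwinnertonDyer.Theorems
  Summit.BirchSwinnertonDyer.Rank1Residual.Supersingular

namespace Summit.BirchSwinnertonDyer.BirchSwinnertonDyer.Theorems.PrintX8SharpFlatMuTransfer

variable (W : WeierstrassCurve ℚ) [W.IsElliptic] [W.IsGloballyMinimal] (p : ℕ) [Fact p.Prime]

/-- **Unit `L`-value ⟹ `L^• ∈ Λˣ` on X8.** For an X8 pair (any image), a newform `f` of `W` with period
ratio `ϖ` (`ϖ·Ω_E = Ω⁺_f`), the Sprung pair `(L♯, L♭)` of `f` and a colour `•`: if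
`L(E,1)/Ω_E = t ∈ ℚ` with `t ≠ 0`, `ord₃ t = 0`, then `chromaticL • L♯ L♭` is a unit of `Λ` — its
constant term is `c_• · [0]⁺_f` (Sprung 2017 Cor. 4.11, tree theorem
`constantCoeff_chromaticL_of_isSprungPair_of_isNewformOf`) with `3 ∤ c_•` on X8
(`ClassX8.not_dvd_chromaticConst'`) and `[0]⁺_f = t/ϖ`, `ϖ` a `3`-adic unit (the period fact at `3`,
`h3`). [cite: Sprung2017, Cor. 4.11 (table of special values)] [cite: GreenbergVatsal2000, §3 Remark 3.4]
[cite: Washington1997, §7.1] -/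
theorem X8.isUnit_chromaticL_of_lvalue_unit (h3 : realPeriodRat_eq_unit_mul_plusPeriod_three)
    (hX : ClassX8 W p) {N : ℕ} [NeZero N] {f : CuspForm (Gamma0 N) 2} (hf : IsNewformOf W f)
    {ϖ : ℚ} (hϖ : (ϖ : ℝ) * W.realPeriodRat = plusPeriod f)
    {Lsharp Lflat : IwasawaAlgebra p} (hSP : IsSprungPair f p (W.frobeniusTrace p) Lsharp Lflat)
    (col : Chroma) {t : ℚ} (ht : W.entireLFunction 1 / (W.realPeriodRat : ℂ) = ((t : ℚ) : ℂ))
    (ht0 : t ≠ 0) (hvt : padicValRat p t = 0) : IsUnit (chromaticL col Lsharp Lflat) := by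
  have hp3 : p = 3 := hX.1
  subst hp3
  have hp : (3 : ℕ) ≠ 2 := by decide
  have hgood : W.HasGoodReductionAtPrime 3 := hX.2.1.1
  have hirr : W.HasIrreducibleModPGaloisRep 3 := ClassX8.irr W 3 hX
  set L : IwasawaAlgebra 3 := chromaticL col Lsharp Lflat with hLdef
  -- the period ratio is a `3`-adic unit
  obtain ⟨u, hu, hΩ⟩ := h3 W hgood hirr f hf
  have hvϖ : padicValRat 3 ϖ = 0 := padicValRat_periodRatio_eq_zero_of_eq_unit_mul W 3 f hu hΩ ϖ hϖ
  have hϖ0 : ϖ ≠ 0 := by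
    intro hz
    rw [hz, Rat.cast_zero, zero_mul] at hϖ
    exact (IsNewform0.plusPeriod_pos_holds hf.1 hf.coeffField_eq_bot).ne' hϖ.symm
  -- (P•): `L(0) = c_• · s`, `s = [0]⁺_f`, and `t = ϖ · s`
  have hLε := constantCoeff_chromaticL_of_isSprungPair_of_isNewformOf hp hf hgood hSP col
  set s : ℚ := ratPlusSymbol f 0 with hs_def
  have hLval : W.entireLFunction 1 = (((s : ℝ) * plusPeriod f : ℝ) : ℂ) := hf.entireLFunction_one_eq
  have hts : t = ϖ * s := by
    have h1 : W.entireLFunction 1 / (W.realPeriodRat : ℂ) = (((ϖ * s : ℚ) : ℝ) : ℂ) := by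
      rw [hLval, ← hϖ, div_eq_iff (Complex.ofReal_ne_zero.mpr W.realPeriodRat_pos_holds.ne')]
      push_cast
      ring
    rw [ht] at h1
    exact_mod_cast h1
  have hs0 : s ≠ 0 := by
    intro hz
    exact ht0 (by rw [hts, hz, mul_zero])
  have hvs : padicValRat 3 s = 0 := by
    have := hvt
    rw [hts, padicValRat.mul hϖ0 hs0, hvϖ, zero_add] at this
    exact this
  -- `c_•` is prime to `3` on X8, so `L(0)` is a `3`-adic unit and `L ∈ Λˣ`
  have hc : ¬ ((3 : ℕ) : ℤ) ∣ chromaticConst 3 (W.frobeniusTrace 3) col :=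
    ClassX8.not_dvd_chromaticConst' W 3 hX col
  have hcne : chromaticConst 3 (W.frobeniusTrace 3) col ≠ 0 := fun hz ↦ hc (by rw [hz]; exact dvd_zero _)
  have hc0 : (chromaticConst 3 (W.frobeniusTrace 3) col : ℚ_[3]) ≠ 0 := by exact_mod_cast hcne
  have hsQ0 : ((s : ℚ) : ℚ_[3]) ≠ 0 := by exact_mod_cast hs0
  have hL0ne : ((PowerSeries.constantCoeff L : ℤ_[3]) : ℚ_[3]) ≠ 0 := by
    rw [hLε]; exact mul_ne_zero hc0 hsQ0
  have hvL : (((PowerSeries.constantCoeff L : ℤ_[3]) : ℚ_[3])).valuation = 0 := by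
    rw [hLε, Padic.valuation_mul hc0 hsQ0, Padic.valuation_intCast,
      padicValInt.eq_zero_of_not_dvd hc, Padic.valuation_ratCast, hvs]
    simp
  have hnorm : ‖((PowerSeries.constantCoeff L : ℤ_[3]) : ℚ_[3])‖ = 1 := by
    rw [Padic.norm_eq_zpow_neg_valuation hL0ne, hvL, neg_zero, zpow_zero]
  have hunit0 : IsUnit (PowerSeries.constantCoeff L : ℤ_[3]) := PadicInt.isUnit_iff.mpr hnorm
  exact PowerSeries.isUnit_iff_constantCoeff.mpr hunit0

/-- **The UNIT CASE at small image, partner-free: X8, `ρ̄_{E,3}` NOT onto, `ord₃(L(E,1)/Ω_E) = 0` ⟹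
Sprung's Main [C] 7.21 for `(E, 3, •)`, BOTH colours.** For every cyclotomic / Honda datum and every
newform `f`, period ratio `ϖ`, Sprung pair and dual datum `D` of `Sel^•(E/ℚ_∞)`: `L^• ∈ Λˣ`
(`X8.isUnit_chromaticL_of_lvalue_unit`), hence `HasUnitContent (L^•)` and, by the μ-transfer
`X8.sharpFlatMu_eq_zero` (construction fact `hCK`), `μ(X^•) = 0`, i.e. a characteristic power series `ξ`
of unit content; Sprung 2012 Thm. 7.16 RATIONAL (`ξ ∣ 3ⁿ L^•`) + Gauss' lemma in `Λ`
(`Additive.dvd_of_dvd_C_pow_mul_of_hasUnitContent`) give `ξ ∣ L^•`, so `ξ ∈ Λˣ` and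
`char X^• = Λ = (ϖ·L^•)`; torsion by Thm. 7.14 (`L^• ≠ 0`). Binders BY NAME: `hCK`, `h714`, `h716`
(rational clause only), `h3`; displayed: `ht`, `ht0`, `hvt` (one rational number per pair). NO K1, NO
partner, NO congruence, NO `BSD(E,3)` input. CONDITIONAL; per pair.
[cite: Sprung2012, Def. 6.1 (p. 1495), Thm. 7.14, Thm. 7.16 (p. 1504) and Main Conj. 7.21 (p. 1505)]
[cite: Sprung2017, Cor. 4.11] [cite: Kato2004Asterisque, Thm. 12.6 (p. 222) and §13.8]
[cite: GreenbergVatsal2000, §3 Remark 3.4] [cite: Washington1997, §7.1, §13.1] -/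
theorem X8.sprungSharpFlatMainConjecture_of_lvalue_unit_of_not_surj
    (hCK : thm714seq_sharpFlatColemanKato_zeta)
    (h714 : thm714_sharpFlatSelmerDual_finite_torsion)
    (h716 : thm716_sharpFlatCharIdeal_divisibility)
    (h3 : realPeriodRat_eq_unit_mul_plusPeriod_three)
    (hX : ClassX8 W p) (hns : ¬ Surj W p)
    {t : ℚ} (ht : W.entireLFunction 1 / (W.realPeriodRat : ℂ) = ((t : ℚ) : ℂ)) (ht0 : t ≠ 0)
    (hvt : padicValRat p t = 0) (col : Chroma) : SprungSharpFlatMainConjecture W p col := by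
  intro κ γ hκ hγ hγ' v hv g hg cneg c hH N hN f ϖ Lsharp Lflat hf hϖ hSP _ D
  haveI := hN
  have hLunit : IsUnit (chromaticL col Lsharp Lflat) :=
    X8.isUnit_chromaticL_of_lvalue_unit W p h3 hX hf hϖ hSP col ht ht0 hvt
  have hp3 : p = 3 := hX.1
  subst hp3
  have hp : (3 : ℕ) ≠ 2 := by decide
  have hgood : W.HasGoodReductionAtPrime 3 := hX.2.1.1
  have hap : ((3 : ℕ) : ℤ) ∣ W.frobeniusTrace 3 := hX.2.1.2
  have hirr : W.HasIrreducibleModPGaloisRep 3 := ClassX8.irr W 3 hX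
  set L : IwasawaAlgebra 3 := chromaticL col Lsharp Lflat with hLdef
  have hcol : L ≠ 0 := hLunit.ne_zero
  -- torsion and finite generation (Thm. 7.14, `L^• ≠ 0`)
  obtain ⟨hfin, hXt⟩ := h714 W 3 hp hgood hap f hf κ γ hκ hγ hγ' v hv g hg cneg c hH col Lsharp Lflat
    hSP hcol D
  haveI := hfin
  refine ⟨hXt, ?_⟩
  -- the period ratio is a `3`-adic unit
  obtain ⟨u, hu, hΩ⟩ := h3 W hgood hirr f hf
  have hvϖ : padicValRat 3 ϖ = 0 := padicValRat_periodRatio_eq_zero_of_eq_unit_mul W 3 f hu hΩ ϖ hϖ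
  have hϖ0 : ϖ ≠ 0 := by
    intro hz
    rw [hz, Rat.cast_zero, zero_mul] at hϖ
    exact (IsNewform0.plusPeriod_pos_holds hf.1 hf.coeffField_eq_bot).ne' hϖ.symm
  -- μ-transfer: `μ(X^•) = 0`, so a characteristic power series `ξ` of unit content
  have huL : HasUnitContent L := by
    obtain ⟨w, hw⟩ := hLunit
    refine ⟨0, ?_⟩
    rw [PowerSeries.coeff_zero_eq_constantCoeff, ← hw]
    exact (PowerSeries.isUnit_iff_constantCoeff.mp w.isUnit)
  have hμ : muInvariant 3 D.X = 0 :=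
    X8.sharpFlatMu_eq_zero W 3 hCK h3 hX hns f hf ϖ hϖ κ γ hκ hγ hγ' v hv g hg cneg c hH col hSP huL D
  obtain ⟨ξ, hξ⟩ := (charIdeal_isPrincipal_holds 3 D.X).principal
  have hξ' : D.charIdeal = Ideal.span {ξ} := hξ
  have huξ : HasUnitContent ξ := (muInvariant_eq_zero_iff_hasUnitContent D.X hXt hξ').mp hμ
  -- Thm. 7.16 rational + Gauss: `ξ ∣ L`, so `ξ` is a unit and `char X^• = Λ = (ϖ·L^•)`
  obtain ⟨n, hn⟩ := h716.exists_dvd_pow_mul hp hgood hap hf hκ hγ hγ' hv hg hH hSP hcol D hXt hξ'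
  have hC : ((3 : ℕ) : IwasawaAlgebra 3) ^ n = PowerSeries.C (((3 : ℕ) : ℤ_[3]) ^ n) := by
    rw [map_pow, map_natCast]
  rw [hC] at hn
  have hU : ξ ∣ L :=
    Summit.BirchSwinnertonDyer.Rank1Residual.Additive.dvd_of_dvd_C_pow_mul_of_hasUnitContent huξ n hn
  have hξunit : IsUnit ξ := isUnit_of_dvd_unit hU hLunit
  obtain ⟨u', hu'⟩ := exists_units_coe_eq_ratCast hϖ0 hvϖ
  obtain ⟨hspan', hι⟩ := span_C_units_mul_eq u' L
  have h1 : D.charIdeal = ⊤ := by rw [hξ']; exact (Ideal.span_singleton_eq_top).mpr hξunit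
  have h2 : Ideal.span ({PowerSeries.C (u' : ℤ_[3]) * L} : Set (IwasawaAlgebra 3)) = ⊤ := by
    rw [hspan']; exact (Ideal.span_singleton_eq_top).mpr hLunit
  exact ⟨PowerSeries.C (u' : ℤ_[3]) * L, h1.trans h2.symm, by rw [hι, hu']⟩

/-- **`BSD(E,3)` at the UNIT small-image X8 pairs of analytic rank `0`, partner-free:** X8, `ρ̄_{E,3}`
NOT onto, `ord_{s=1} L(E,s) = 0` and `ord₃(L(E,1)/Ω_E) = 0` ⟹ `BSDp W 3`. The unit case of Main [C]
7.21 (`X8.sprungSharpFlatMainConjecture_of_lvalue_unit_of_not_surj`, both colours) fed into p1 g0's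
IMAGE-FREE rank-zero road `X8MainConjectureRoad.X8.bsdp_of_sprungSharpFlatMainConjecture_of_analyticRank_eq_zero`
(Sprung 2024 §5.2 for all `N`). Binders BY NAME: the construction fact `hCK`
(`Sprung2012.thm714seq_sharpFlatColemanKato_zeta`), modularity (`hmodf`, `hmod`), Sprung 2012 Thm. 2.2
(`h22`), Thm. 7.14 (`h714`), Thm. 7.16 rational (`h716`), Sprung 2024 Lemma 5.9 all `N` (`h59`, flag
`Sprung24-§5.2-allN-via-RaySprung25`), the period unit at `3` (`h3`), GZK (`hGZK`); displayed: the unit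
`L`-value `t` (one rational number per pair). The first by-name road reaching the population's 2 unit
N_ns(3) cells (135200bx1, 442225bz1; ref U1: no printed upper half there). CONDITIONAL; per pair; closes
nothing class-wide. [cite: Sprung2012, Def. 6.1, Thm. 2.2, Thm. 7.14, Thm. 7.16, Main Conj. 7.21]
[cite: Sprung2024, §5.2 Lemmas 5.5–5.9 (pp. 40–41)] [cite: Kato2004Asterisque, Thm. 12.6 (p. 222), §13.8]
[cite: Miller2011LMS, Def. 1.1] -/
theorem X8.bsdp_of_lvalue_unit_of_not_surj_of_analyticRank_eq_zero
    (hCK : thm714seq_sharpFlatColemanKato_zeta)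
    (hmodf : exists_isNewformOf) (h22 : thm22_exists_isHondaSystem)
    (h714 : thm714_sharpFlatSelmerDual_finite_torsion)
    (h716 : thm716_sharpFlatCharIdeal_divisibility)
    (h59 : lem59AllN_sharpFlatCharValue_rankZero)
    (h3 : realPeriodRat_eq_unit_mul_plusPeriod_three)
    (hGZK : rank_eq_analyticRank_of_analyticRank_le_one) (hmod : hasEntireLFunction_rat)
    (hX : ClassX8 W p) (hns : ¬ Surj W p) (h0 : W.analyticRank = 0)
    {t : ℚ} (ht : W.entireLFunction 1 / (W.realPeriodRat : ℂ) = ((t : ℚ) : ℂ))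
    (hvt : padicValRat p t = 0) : BSDp W p := by
  have hL1 : W.entireLFunction 1 ≠ 0 := (W.analyticRank_eq_zero_iff_holds (hmod W)).1 h0
  have ht0 : t ≠ 0 := by
    intro hz
    rw [hz] at ht
    have : W.entireLFunction 1 = 0 := by
      have hΩ : (W.realPeriodRat : ℂ) ≠ 0 := Complex.ofReal_ne_zero.mpr W.realPeriodRat_pos_holds.ne'
      rw [div_eq_iff hΩ] at ht
      rw [ht]; push_cast; ring
    exact hL1 this
  exact X8MainConjectureRoad.X8.bsdp_of_sprungSharpFlatMainConjecture_of_analyticRank_eq_zero hmodf h22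
    h714 h59 h3 hGZK hmod W p hX h0 fun col ↦
      X8.sprungSharpFlatMainConjecture_of_lvalue_unit_of_not_surj W p hCK h714 h716 h3 hX hns ht ht0
        hvt col

end Summit.BirchSwinnertonDyer.BirchSwinnertonDyer.Theorems.PrintX8SharpFlatMuTransfer

end
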